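import Summits.CriticalPhenomena.CardyFormulaZ2.Theorems.CardyBoundaryCoulombGasHalfPlaneMarkDensityLawShortArcFar

/-!
# Line `Sketch`, self-duality programme, Stage II: the left end-zone estimate `endZoneL_small`
# (crux stmt-CriticalPhenomena-5661, lead c3-0)

In the thinning inequality for the half-plane arc-crossing function of bond-`ℤ²` percolation at
`p = 1/2`, the `H`-cluster (`H = ℤ × ℕ`) of the arc `[1, S] × {0}` (`S = ⌊σn⌋`) joined to the ray
`(-∞, -X] × {0}` (`X = ⌊xn⌋`) is studied through its touches of the ray window
`[-X-W, -X] × {0}`, `W = ⌊Ln⌋`.  This file bounds the three left "escape / end-zone" events: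

1. `[1, S] × {0}` is joined in `H` to the far ray `{v₀ < -X-W} × {0}`;
2. the short arc `[-X-W, -X-W+⌊δn⌋] × {0}` is joined in `H` to `[1, S] × {0}`;
3. the short arc `[-X-⌊δn⌋, -X] × {0}` is joined in `H` to `[1, S] × {0}`.

All three are instances of the tree's one-arm end-zone estimate `shortArc_far`
(`P_{1/2}[[p, p+ℓ] × {0} ↔ T in H] ≤ C ((ℓ+1)/(ℓ+D))^α` for `T` at sup-distance `> ℓ + D` from
`(p, 0)`): the three ratios are `≤ σ/L`, `≤ (⌊δn⌋+1)/X` and `≤ (⌊δn⌋+1)/X`, all `≤ η` once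
`L = σ/η + σ + 1`, `δ ≤ ηx/4` and `n` is large, where `C η^α ≤ ε`.
-/

noncomputable section

namespace Summit.CriticalPhenomena.CardyFormulaZ2.Cruxes.HalfPlaneMarkDensityLaw.SketchLine.SelfDual

open Literature.Probability.Percolation Literature.Probability.LatticeModels
open MeasureTheory Filter Set SimpleGraph
open Summit.CriticalPhenomena.CardyFormulaZ2.Theorems.HalfPlaneMarkDensityLaw.Negative

/-- Power-law smallness: for `C, α, ε > 0` there is `η ∈ (0, 1]` with `C t^α ≤ ε` for all
`t ∈ [0, η]` (take `η = min 1 ((ε/C)^{1/α})`). [folklore] -/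
private lemma exists_eta_rpow_le {C α ε : ℝ} (hC : 0 < C) (hα : 0 < α) (hε : 0 < ε) :
    ∃ η : ℝ, 0 < η ∧ η ≤ 1 ∧ ∀ t : ℝ, 0 ≤ t → t ≤ η → C * t ^ α ≤ ε := by
  refine ⟨min 1 ((ε / C) ^ α⁻¹), lt_min one_pos (Real.rpow_pos_of_pos (div_pos hε hC) _),
    min_le_left _ _, fun t ht0 htη => ?_⟩
  have h1 : t ≤ (ε / C) ^ α⁻¹ := htη.trans (min_le_right _ _)
  have h2 : t ^ α ≤ ((ε / C) ^ α⁻¹) ^ α := Real.rpow_le_rpow ht0 h1 hα.le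
  rw [Real.rpow_inv_rpow (div_pos hε hC).le hα.ne'] at h2
  calc C * t ^ α ≤ C * (ε / C) := mul_le_mul_of_nonneg_left h2 hC.le
    _ = ε := by field_simp

/-- Integer form of the end-zone estimate `shortArc_far`: for a boundary arc `[a, b] × {0}`
(`a ≤ b`) and a set `T` of sites `f` with `|f 0 - a| > M` or `|f 1| > M`, where `M ≥ b - a + 1`,
`P_{1/2}[[a, b] × {0} ↔ T in ℤ × ℕ] ≤ C ((b - a + 1)/M)^α`. [folklore] -/
private theorem arc_far_int : ∃ C α : ℝ, 0 < C ∧ 0 < α ∧ ∀ (a b M : ℤ) (T : Set (Site 2)),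
    a ≤ b → b - a + 1 ≤ M → (∀ f ∈ T, M < |f 0 - a| ∨ M < |f 1|) →
      μ.real (openCrossing halfPlane (rowIcc a b) T) ≤ C * (((b : ℝ) - a + 1) / M) ^ α := by
  obtain ⟨C, α, hC, hα, h⟩ := shortArc_far
  refine ⟨C, α, hC, hα, fun a b M T hab hM hT => ?_⟩
  obtain ⟨ℓ, hℓ⟩ := Int.eq_ofNat_of_zero_le (sub_nonneg.mpr hab)
  obtain ⟨D, hD⟩ := Int.eq_ofNat_of_zero_le (show (0 : ℤ) ≤ M - (b - a) by omega)
  obtain rfl : b = a + ℓ := by omega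
  obtain rfl : M = ℓ + D := by omega
  have e : (((a + (ℓ : ℤ) : ℤ) : ℝ) - a + 1) / ((((ℓ : ℤ) + (D : ℤ) : ℤ)) : ℝ) =
      ((ℓ : ℝ) + 1) / ((ℓ : ℝ) + D) := by
    push_cast; ring
  rw [e]
  exact h a ℓ D T hT (by omega)

/-- Smallness form of the end-zone estimate: for every `ε > 0` there is `η ∈ (0, 1]` such that
`P_{1/2}[[a, b] × {0} ↔ T in ℤ × ℕ] ≤ ε` whenever `T` is at distance `> M ≥ b - a + 1` from `(a, 0)`
(in the sense of `shortArc_far`) and `b - a + 1 ≤ η M`. [folklore] -/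
private theorem arc_far_small {ε : ℝ} (hε : 0 < ε) : ∃ η : ℝ, 0 < η ∧ η ≤ 1 ∧
    ∀ (a b M : ℤ) (T : Set (Site 2)), a ≤ b → b - a + 1 ≤ M →
      (∀ f ∈ T, M < |f 0 - a| ∨ M < |f 1|) → ((b : ℝ) - a + 1) ≤ η * M →
        μ.real (openCrossing halfPlane (rowIcc a b) T) ≤ ε := by
  obtain ⟨C, α, hC, hα, h⟩ := arc_far_int
  obtain ⟨η, hη, hη1, hsmall⟩ := exists_eta_rpow_le hC hα hε
  refine ⟨η, hη, hη1, fun a b M T hab hM hT hreal =>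
    (h a b M T hab hM hT).trans (hsmall _ ?_ ?_)⟩
  · have hM' : (0 : ℝ) < M := by exact_mod_cast (show (0 : ℤ) < M by omega)
    have hnum : (0 : ℝ) ≤ (b : ℝ) - a + 1 := by
      have : ((0 : ℤ) : ℝ) ≤ ((b - a + 1 : ℤ) : ℝ) := by
        exact_mod_cast (show (0 : ℤ) ≤ b - a + 1 by omega)
      push_cast at this
      linarith
    exact div_nonneg hnum hM'.le
  · have hM' : (0 : ℝ) < M := by exact_mod_cast (show (0 : ℤ) < M by omega)
    exact (div_le_iff₀ hM').mpr hreal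

/-- **Left end zones are negligible.** For `σ, x, ε > 0` there are `L > 0` and `δ₀ > 0` such that
for every `δ ∈ (0, δ₀]`, eventually in `n` (with `S = ⌊σn⌋`, `X = ⌊xn⌋`, `W = ⌊Ln⌋`, `H = ℤ × ℕ`):
`P_{1/2}[[1,S]×{0} ↔ {v₀ < -X-W}×{0} in H] ≤ ε`,
`P_{1/2}[[-X-W, -X-W+⌊δn⌋]×{0} ↔ [1,S]×{0} in H] ≤ ε` and
`P_{1/2}[[-X-⌊δn⌋, -X]×{0} ↔ [1,S]×{0} in H] ≤ ε` — three instances of the one-arm end-zone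
estimate `shortArc_far` with ratios `≤ σ/L`, `≤ (⌊δn⌋+1)/X`, `≤ (⌊δn⌋+1)/X`. [folklore] -/
theorem endZoneL_small : ∀ {σ x : ℝ}, 0 < σ → 0 < x → ∀ {ε : ℝ}, 0 < ε → ∃ L : ℝ, 0 < L ∧ ∃ δ₀ : ℝ, 0 < δ₀ ∧ ∀ δ : ℝ, 0 < δ → δ ≤ δ₀ → ∀ᶠ n : ℕ in atTop, μ.real (openCrossing halfPlane (rowIcc 1 ⌊σ * n⌋) {v : Site 2 | v 1 = 0 ∧ v 0 < -⌊x * n⌋ - ⌊L * n⌋}) ≤ ε ∧ μ.real (openCrossing halfPlane (rowIcc (-⌊x * n⌋ - ⌊L * n⌋) (-⌊x * n⌋ - ⌊L * n⌋ + ⌊δ * n⌋)) (rowIcc 1 ⌊σ * n⌋)) ≤ ε ∧ μ.real (openCrossing halfPlane (rowIcc (-⌊x * n⌋ - ⌊δ * n⌋) (-⌊x * n⌋)) (rowIcc 1 ⌊σ * n⌋)) ≤ ε := by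
  intro σ x hσ hx ε hε
  obtain ⟨η, hη, hη1, hfar⟩ := arc_far_small hε
  have hηne : η ≠ 0 := hη.ne'
  set L : ℝ := σ / η + σ + 1 with hL
  have hLpos : 0 < L := by positivity
  have hσL : σ ≤ L := by
    have : 0 < σ / η := div_pos hσ hη
    rw [hL]; linarith
  have hηL : σ ≤ η * L := by
    have h1 : η * (σ / η) = σ := by field_simp
    have h2 : η * L = η * (σ / η) + η * σ + η := by rw [hL]; ring
    have h3 : 0 < η * σ := mul_pos hη hσ
    linarith
  refine ⟨L, hLpos, η * x / 4, by positivity, fun δ hδ hδ₀ => ?_⟩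
  filter_upwards [tendsto_natCast_atTop_atTop.eventually_ge_atTop (1 / σ),
    tendsto_natCast_atTop_atTop.eventually_ge_atTop (4 / (η * x))] with n hn1 hn2
  -- real bookkeeping
  have hn0 : (0 : ℝ) ≤ n := n.cast_nonneg
  have hσn : 1 ≤ σ * n := by
    have := (div_le_iff₀ hσ).mp hn1
    linarith
  have hηx : 0 < η * x := mul_pos hη hx
  have hηxn : 4 ≤ η * x * n := by
    have := (div_le_iff₀ hηx).mp hn2
    linarith
  have hxn : 4 ≤ x * n := by
    have : 0 ≤ (1 - η) * (x * n) := mul_nonneg (sub_nonneg.mpr hη1) (mul_nonneg hx.le hn0)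
    nlinarith
  have hS := Int.floor_le (σ * n)
  have hX := Int.lt_floor_add_one (x * n)
  have hW := Int.lt_floor_add_one (L * n)
  have hℓ := Int.floor_le (δ * n)
  -- integer bookkeeping
  have iS : 1 ≤ ⌊σ * n⌋ := Int.le_floor.mpr (by push_cast; exact hσn)
  have iX : 1 ≤ ⌊x * n⌋ := Int.le_floor.mpr (by push_cast; linarith)
  have iW : ⌊σ * n⌋ ≤ ⌊L * n⌋ := Int.floor_le_floor (mul_le_mul_of_nonneg_right hσL hn0)
  have iℓ : 0 ≤ ⌊δ * n⌋ := Int.floor_nonneg.mpr (by positivity)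
  have iW0 : 0 ≤ ⌊L * n⌋ := Int.floor_nonneg.mpr (by positivity)
  have iX0 : 0 ≤ ⌊x * n⌋ := by omega
  have rX0 : (0 : ℝ) ≤ ⌊x * n⌋ := by exact_mod_cast iX0
  have rW0 : (0 : ℝ) ≤ ⌊L * n⌋ := by exact_mod_cast iW0
  have rℓ0 : (0 : ℝ) ≤ ⌊δ * n⌋ := by exact_mod_cast iℓ
  -- the key real inequality `⌊δn⌋ + 1 ≤ η X`
  have hδn : δ * n ≤ η * x / 4 * n := mul_le_mul_of_nonneg_right hδ₀ hn0
  have hηX : η * (x * n) < η * ((⌊x * n⌋ : ℝ) + 1) := mul_lt_mul_of_pos_left hX hη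
  have key : ((⌊δ * n⌋ : ℝ)) + 1 ≤ η * (⌊x * n⌋ : ℝ) := by nlinarith
  have iXℓ : 1 ≤ ⌊x * n⌋ - ⌊δ * n⌋ := by
    have h1 : 0 ≤ (1 - η) * (⌊x * n⌋ : ℝ) := mul_nonneg (sub_nonneg.mpr hη1) rX0
    have h2 : (⌊δ * n⌋ : ℝ) < (⌊x * n⌋ : ℝ) := by nlinarith
    have h3 : ⌊δ * n⌋ < ⌊x * n⌋ := by exact_mod_cast h2
    omega
  refine ⟨hfar 1 _ (⌊x * n⌋ + ⌊L * n⌋ + 1) _ iS (by omega) ?_ ?_,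
    hfar _ _ (⌊x * n⌋ + ⌊L * n⌋) _ (by omega) (by omega) ?_ ?_,
    hfar _ _ (⌊δ * n⌋ + ⌊x * n⌋) _ (by omega) (by omega) ?_ ?_⟩
  · rintro f ⟨-, hf0⟩
    exact Or.inl (lt_abs.mpr (Or.inr (by omega)))
  · push_cast
    have h1 : η * (L * n) < η * ((⌊L * n⌋ : ℝ) + 1) := mul_lt_mul_of_pos_left hW hη
    have h2 : σ * n ≤ η * L * n := mul_le_mul_of_nonneg_right hηL hn0
    have h3 : (0 : ℝ) ≤ η * ⌊x * n⌋ := mul_nonneg hη.le rX0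
    nlinarith
  · rintro f ⟨-, hf0, -⟩
    exact Or.inl (lt_abs.mpr (Or.inl (by omega)))
  · push_cast
    have h3 : (0 : ℝ) ≤ η * ⌊L * n⌋ := mul_nonneg hη.le rW0
    nlinarith
  · rintro f ⟨-, hf0, -⟩
    exact Or.inl (lt_abs.mpr (Or.inl (by omega)))
  · push_cast
    have h3 : (0 : ℝ) ≤ η * ⌊δ * n⌋ := mul_nonneg hη.le rℓ0
    nlinarith

end Summit.CriticalPhenomena.CardyFormulaZ2.Cruxes.HalfPlaneMarkDensityLaw.SketchLine.SelfDual
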